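import Summits.QuantumFields.YangMills.Theorems.AllWindowsColdBoxBoxHighLineBoxImageGradient

/-!
# Gradient of the box Dirichlet Green function at coincident points (companion of `…BoxImageGradient`)

Route `AllWindowsColdBox`, LINE-19 S3 / LINE-20 U1 (crux ⟨stmt-QuantumFields-24336⟩, parent ⟨24004⟩; STUB-PLAN-U1 rev 2 §6 (A)).  The off-diagonal
bound ✓`dirichletGreen_interiorSites_grad_mul_dist_pow_three_le` (`|∇G_I(x,y)|·|x−y|³ ≤ C`, `x ≠ y`) is complemented by the coincident-point bound

* **`abs_dirichletGreen_grad_diag_le`** — `|G_I(x + eᵢ, x) − G_I(x, x)| ≤ C` for every interior `x`, uniformly in `H`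

(image `S = ∅` sits at the torus origin, where `|G̃(eᵢ) − G̃(0)| ≤ 1` by ✓`abs_torusGreen_second_difference_zero_le` and reflection; the 15 proper images
are non-zero torus points, where the uniform gradient bound applies with `dist ≥ 1`).  Together: `|∇ₓG_I(x,y)| ≤ C′(1 + |x − y|)⁻³` for all interior
`x, y`.  Everything proved; no definitions; standard axioms.  HONEST LABEL: helper; no stub, crux, rung or summit is proved; the Yang–Mills mass gap is
NOT proved by this file.
-/

set_option autoImplicit false

noncomputable section

namespace Summit.QuantumFields.YangMills.Theorems.AllWindowsColdBoxBoxHighLine.BoxImage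

open Finset
open Literature.Probability.LatticeModels
open Summit.QuantumFields.YangMills.Theorems.AllWindowsColdBox.BoxKernel (torusGreen_reflect abs_torusGreen_second_difference_zero_le
  one_le_sqrt_sum_valMinAbs_sq)
open Summit.QuantumFields.YangMills.Theorems.AllWindowsColdBox.TorusGreenGradient (torusGreen_grad_mul_dist_pow_three_le)

variable {L : ℕ} [NeZero L]

/-- `|G̃(eᵢ) − G̃(0)| ≤ 1` on every torus (`G̃(−eᵢ) = G̃(eᵢ)` by reflection, and `0 ≤ 2G̃(0) − G̃(eᵢ) − G̃(−eᵢ) ≤ 2`). -/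
theorem abs_torusGreen_single_sub_zero_le (i : Fin 4) :
    |torusGreen ((0 : TorusSite 4 L) + Pi.single i 1) - torusGreen (0 : TorusSite 4 L)| ≤ 1 := by
  have h2 := abs_torusGreen_second_difference_zero_le (L := L) (d := 4) i
  have hrefl : torusGreen ((0 : TorusSite 4 L) - Pi.single i 1) = torusGreen ((0 : TorusSite 4 L) + Pi.single i 1) := by
    set e : TorusSite 4 L := (0 : TorusSite 4 L) + Pi.single i 1 with he
    have key : (0 : TorusSite 4 L) - Pi.single i 1 = Function.update e i (-e i) := by
      funext k
      by_cases hk : k = i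
      · subst hk; simp [he]
      · simp [he, Function.update_of_ne hk, Pi.single_eq_of_ne hk]
    rw [key, torusGreen_reflect]
  rw [hrefl] at h2
  have : |torusGreen ((0 : TorusSite 4 L) + Pi.single i 1) - torusGreen (0 : TorusSite 4 L)| =
      |2 * torusGreen (0 : TorusSite 4 L) - torusGreen ((0 : TorusSite 4 L) + Pi.single i 1) -
        torusGreen ((0 : TorusSite 4 L) + Pi.single i 1)| / 2 := by
    rw [show 2 * torusGreen (0 : TorusSite 4 L) - torusGreen ((0 : TorusSite 4 L) + Pi.single i 1) -
        torusGreen ((0 : TorusSite 4 L) + Pi.single i 1) =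
        (-2) * (torusGreen ((0 : TorusSite 4 L) + Pi.single i 1) - torusGreen (0 : TorusSite 4 L)) by ring,
      abs_mul, abs_neg, abs_two]
    ring
  rw [this]
  linarith

variable {H : ℕ} [NeZero H]

/-- **Coincident-point gradient bound**: `|G_I(x + eᵢ, x) − G_I(x, x)| ≤ C` for every interior `x`, uniformly in `H`. -/
theorem abs_dirichletGreen_grad_diag_le : ∃ C : ℝ, ∀ (H : ℕ) [NeZero H] (x : Site 4) (i : Fin 4), x ∈ interiorSites H →
    |dirichletGreen (interiorSites H) (x + Pi.single i 1) x - dirichletGreen (interiorSites H) x x| ≤ C := by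
  obtain ⟨C₁, hC₁⟩ := torusGreen_grad_mul_dist_pow_three_le
  refine ⟨8 * max C₁ 1, ?_⟩
  intro H _ x i hx
  set Y : Finset (Fin 4) → TorusSite 4 (4 * H) :=
    fun S k => if k ∈ S then -((x k : ℤ) : ZMod (4 * H)) else ((x k : ℤ) : ZMod (4 * H)) with hY
  set X : TorusSite 4 (4 * H) := fun k => ((x k : ℤ) : ZMod (4 * H)) with hX
  rw [dirichletGreen_add_single_eq_imageSum hx hx i, dirichletGreen_interiorSites_eq_imageSum hx hx, ← mul_sub,
    ← Finset.sum_sub_distrib]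
  have hterm : ∀ S : Finset (Fin 4), |torusGreen (X - Y S + Pi.single i 1) - torusGreen (X - Y S)| ≤ max C₁ 1 := by
    intro S
    by_cases hz : X - Y S = 0
    · rw [hz, zero_add]
      have := abs_torusGreen_single_sub_zero_le (L := 4 * H) i
      rw [zero_add] at this
      exact this.trans (le_max_right _ _)
    · have h1 := hC₁ (4 * H) i (X - Y S) hz
      have hd := one_le_sqrt_sum_valMinAbs_sq hz
      have hd3 : 1 ≤ Real.sqrt (∑ k : Fin 4, ((((X - Y S) k).valMinAbs : ℤ) : ℝ) ^ 2) ^ 3 := one_le_pow₀ hd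
      have h0 : 0 ≤ |torusGreen (X - Y S + Pi.single i 1) - torusGreen (X - Y S)| := abs_nonneg _
      calc |torusGreen (X - Y S + Pi.single i 1) - torusGreen (X - Y S)|
          ≤ |torusGreen (X - Y S + Pi.single i 1) - torusGreen (X - Y S)| *
              Real.sqrt (∑ k : Fin 4, ((((X - Y S) k).valMinAbs : ℤ) : ℝ) ^ 2) ^ 3 := le_mul_of_one_le_right h0 hd3
        _ ≤ C₁ := h1
        _ ≤ max C₁ 1 := le_max_left _ _
  rw [abs_mul, abs_of_pos (by norm_num : (0 : ℝ) < 1 / 2)]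
  calc 1 / 2 * |∑ S : Finset (Fin 4), ((-1 : ℝ) ^ S.card * torusGreen (X - Y S + Pi.single i 1) -
        (-1 : ℝ) ^ S.card * torusGreen (X - Y S))|
      ≤ 1 / 2 * ∑ S : Finset (Fin 4), |(-1 : ℝ) ^ S.card * torusGreen (X - Y S + Pi.single i 1) -
        (-1 : ℝ) ^ S.card * torusGreen (X - Y S)| := by
          gcongr; exact Finset.abs_sum_le_sum_abs _ _
    _ = 1 / 2 * ∑ S : Finset (Fin 4), |torusGreen (X - Y S + Pi.single i 1) - torusGreen (X - Y S)| := by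
          congr 1
          refine Finset.sum_congr rfl fun S _ => ?_
          rw [← mul_sub, abs_mul, abs_pow, abs_neg, abs_one, one_pow, one_mul]
    _ ≤ 1 / 2 * ∑ _S : Finset (Fin 4), max C₁ 1 := by gcongr with S _; exact hterm S
    _ = 1 / 2 * (16 * max C₁ 1) := by
          congr 1
          rw [Finset.sum_const, Finset.card_univ, Fintype.card_finset, Fintype.card_fin, nsmul_eq_mul]; norm_num
    _ = 8 * max C₁ 1 := by ring

end Summit.QuantumFields.YangMills.Theorems.AllWindowsColdBoxBoxHighLine.BoxImage

end
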